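import Summits.MatrixMultiplication.MatrixMultiplication.Theorems.TetraDiagonalCover
import Literature.Computability.AlgebraicComplexity.RectangularExponentProofs
import HarnessLib

/-!
# TetraDiagonalCostume — thinned tetrahedron carvings have a summit-equivalent residual
(the summand test and profile strictness at `1`)

(decomp-mm lens 6 «barrier-complement carving», generation 19; kernel B of NODE-g19, on the RESIDUAL
side of the cut of record `ω = 2 ⟺ TetraFlat ∧ TetraNoSaving` (route `TetrahedronCarving`; the
residual `TetraNoSaving`, item 33478, is declared residual). No item is added or changed.)

QUESTION (costume census of weighted-`K₄` carvings). Every weighting `w` of the edges of `K₄` gives an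
exact carving `ω = 2 ⟺ [ω(Z_w) ≤ L(w)] ∧ [(L(w)/2)·ω ≤ ω(Z_w)]` (`L(w)` = the flattening value); the
uniform `w ≡ 1` is the cut of record (`L = 4`), the hub-rim weightings are the banked Cone / Sesqui
asides. WHICH residuals `(L/2)·ω ≤ ω(Z_w)` are genuinely weaker than the summit, and which are the
summit in costume? This file settles the DIAGONAL THINNINGS `w = (ε on the matching {01,23}, 1 on the
4-cycle)`, `0 ≤ ε < 1` — the family `Z_n^{(⌈n^ε⌉)}` of kernel A with exponent `ω_diag(ε)`, `L = 4`:

* `matrixMultiplication_iff_diagFlat_and_diagNoSaving` — the carving IS exact for every `ε ∈ [0,1]`: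
  `ω = 2 ⟺ ω_diag(ε) ≤ 4 ∧ 2ω ≤ ω_diag(ε)`;
* `omega_eq_two_of_two_mul_omega_le_omegaDiag` — but for `ε < 1` the residual ALONE is the summit:
  `2ω ≤ ω_diag(ε) ⟹ ω = 2` (`two_mul_omega_le_omegaDiag_iff`), because the cover of kernel A3,
  `ω_diag(ε) ≤ 4(1-ε) + ε·ω(K₄) ≤ 4(1-ε) + 2εω`, has slope `2ε < 2` in `ω`. Equivalently
  (`omegaDiag_lt_two_mul_omega`): unless `ω = 2`, EVERY thinned tetrahedron family saves over the
  trivial `2ω` — among the diagonal deformations only the uniform tetrahedron (`ε = 1`, item 33478,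
  `tetraNoSaving_iff_omegaTetra_eq`) can carry a residual that is not summit-equivalent.

The two exponent-level principles behind it, stated abstractly for reuse by the costume census:
* `omega_eq_two_of_flatSummand` (SUMMAND TEST): a cover `z ≤ λ·ω(K₄) + g` through a `λ`-fold
  tetrahedron plus a CO-FLAT flat remainder of exponent `g > 0`, together with the exact residual
  `(2λ + g/2)·ω ≤ z`, forces `ω = 2`. (The residual constant of an exact carving is `L/2`; the test
  bites iff `L ≥ 4λ + g`, i.e. one bipartition flattens both summands maximally — true for
  `Z^ε = ε·K₄ ⊕ (1-ε)·C₄` with the cut `{0,1}|{2,3}`, false for the hub-rim cones, where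
  `L(W) = 6 < 4 + 3`, which is why `ConeNoSaving` / `SesquiNoSaving` are not caught.)
* `omega_eq_two_of_omega_le_omegaRect_one_mid_one` (PROFILE STRICTNESS AT `1`): `ω ≤ ω(1,k,1)` for
  some `0 ≤ k < 1` forces `ω = 2` (Lotti–Romani convexity between `ω(1,0,1) = 2` and `ω(1,1,1) = ω`);
  hence single-edge thinnings, covered by `z ≤ ω + ω(1,k,1)`, are costumes too
  (`omega_eq_two_of_cover_by_profile`).
Sources: [corpus:paper-arxiv-1609.07476 Prop. 1.1.16, Prop. 1.1.26] · [cite: LottiRomani1983, §1]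
(tree `omegaRect_convexOn_middle_holds`) · kernels A1–A3 (`TetraDiagonal{Core,Ladder,Cover}`).
-/

noncomputable section

set_option linter.dupNamespace false

open Literature.Computability.AlgebraicComplexity
open Summit.MatrixMultiplication.MatrixMultiplication.Theorems.TetrahedronTensor
open Summit.MatrixMultiplication.MatrixMultiplication.Theses.TetrahedronCarving

namespace Summit.MatrixMultiplication.MatrixMultiplication.Theorems.TetraDiagonal

/-! ## §8 Profile strictness at `1` and the abstract summand test -/

section Summand

variable (F : Type) [Field F]

/-- **Strictness of the profile at `1`**: if `ω ≤ ω(1, k, 1)` for some `0 ≤ k < 1` then `ω = 2`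
(Lotti–Romani convexity of `k ↦ ω(1,k,1)` between `ω(1,0,1) = 2` and `ω(1,1,1) = ω`: the chord gives
`ω(1,k,1) ≤ 2(1-k) + kω`). Contrapositive: `ω > 2 ⟹ ω(1,k,1) < ω` for every `k < 1`.
[cite: LottiRomani1983, §1 (p. 173)] -/
theorem omega_eq_two_of_omega_le_omegaRect_one_mid_one {k : ℝ} (hk0 : 0 ≤ k) (hk1 : k < 1)
    (h : omega F ≤ omegaRect F 1 k 1) : omega F = 2 := by
  have hconv := omegaRect_convexOn_middle_holds F
  have hk' := hconv.2 (Set.mem_Ici.2 (le_refl (0 : ℝ))) (Set.mem_Ici.2 (zero_le_one : (0 : ℝ) ≤ 1))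
    (show (0 : ℝ) ≤ 1 - k by linarith) hk0 (show (1 - k) + k = 1 by ring)
  simp only [smul_eq_mul, mul_zero, zero_add, mul_one] at hk'
  rw [omegaRect_one_zero_one F, omegaRect_one_one_one F] at hk'
  have h2 := omega_two_le F
  have hmul : omega F * (1 - k) ≤ 2 * (1 - k) := by linarith
  have hle : omega F ≤ 2 := le_of_mul_le_mul_right hmul (by linarith)
  exact le_antisymm hle h2

/-- **Single-edge thinning is a costume.** If a carving target is covered by the two full triangles
off a thinned edge of weight `k < 1` plus the two rectangular half-triangles through it,
`z ≤ ω + ω(1,k,1)`, then its exact residual `2ω ≤ z` already gives `ω = 2`.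
[cite: LottiRomani1983, §1 (p. 173)] -/
theorem omega_eq_two_of_cover_by_profile {k z : ℝ} (hk0 : 0 ≤ k) (hk1 : k < 1)
    (hcov : z ≤ omega F + omegaRect F 1 k 1) (hres : 2 * omega F ≤ z) : omega F = 2 :=
  omega_eq_two_of_omega_le_omegaRect_one_mid_one F hk0 hk1 (by linarith)

/-- **The summand test.** If a carving target `Z` is covered through a `λ`-fold tetrahedron plus a
flat remainder of exponent `g > 0` — `z ≤ λ·ω(K₄) + g` — then the residual with constant `2λ + g/2`,
`(2λ + g/2)·ω ≤ z`, already implies `ω = 2`: with `ω(K₄) ≤ 2ω`, `(g/2)·ω ≤ g`. (The exact residual of a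
carving has constant `L/2`, `L` the flattening value; it has this form iff `L ≥ 4λ + g`, i.e. the two
summands are co-flat.) [cite: ChristandlVranaZuiddam2016, Prop. 1.1.26] -/
theorem omega_eq_two_of_flatSummand {lam g z : ℝ} (hlam : 0 ≤ lam) (hg : 0 < g)
    (hcov : z ≤ lam * omegaTetra F + g) (hres : (2 * lam + g / 2) * omega F ≤ z) :
    omega F = 2 := by
  have ht := omegaTetra_le_two_mul_omega F
  have h2 := omega_two_le F
  have hlt : lam * omegaTetra F ≤ lam * (2 * omega F) := mul_le_mul_of_nonneg_left ht hlam
  have hmul : omega F * (g / 2) ≤ 2 * (g / 2) := by nlinarith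
  have hle : omega F ≤ 2 := le_of_mul_le_mul_right hmul (by linarith)
  exact le_antisymm hle h2

/-- **Thin diagonals, abstract form.** Any cover bound `z ≤ ε·ω(K₄) + 4(1-ε)` (the edge-wise splitting
`Z^ε = ε·K₄ ⊕ (1-ε)·C₄`, `C₄` flat of exponent `4`) turns the exact residual `2ω ≤ z` into `ω = 2`
whenever `0 ≤ ε < 1`. [cite: ChristandlVranaZuiddam2016, Prop. 1.1.26] -/
theorem omega_eq_two_of_thinDiagonal_noSaving {ε z : ℝ} (hε0 : 0 ≤ ε) (hε1 : ε < 1)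
    (hcov : z ≤ ε * omegaTetra F + 4 * (1 - ε)) (hres : 2 * omega F ≤ z) : omega F = 2 :=
  omega_eq_two_of_flatSummand F (lam := ε) (g := 4 * (1 - ε)) hε0 (by linarith) hcov
    (by
      have h : (2 * ε + 4 * (1 - ε) / 2) = 2 := by ring
      rw [h]
      exact hres)

end Summand

/-! ## §9 The thinned tetrahedra: exact carvings whose residual is the summit in costume -/

section Costume

variable (F : Type) [Field F]

/-- **Tensor-level costume theorem**: for the thin-diagonal family with `0 ≤ ε < 1`, the no-saving
residual `2ω ≤ ω_diag(ε)` implies `ω = 2` (cover of kernel A3 + the summand test).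
[cite: ChristandlVranaZuiddam2016, Prop. 1.1.16 (proof)] -/
theorem omega_eq_two_of_two_mul_omega_le_omegaDiag {ε : ℝ} (hε0 : 0 ≤ ε) (hε1 : ε < 1)
    (h : 2 * omega F ≤ omegaDiag F ε) : omega F = 2 :=
  omega_eq_two_of_thinDiagonal_noSaving F hε0 hε1
    (by have hc := omegaDiag_le_cover F hε0 hε1.le; linarith) h

/-- **Unless `ω = 2`, every thinned tetrahedron family saves**: `ω ≠ 2 ⟹ ω_diag(ε) < 2ω` for
`0 ≤ ε < 1` — in contrast with the uniform tetrahedron, for which `ω(K₄) < 2ω` is the (open, declared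
residual) content of item 33478. [cite: ChristandlVranaZuiddam2016, Prop. 1.1.16 (proof)] -/
theorem omegaDiag_lt_two_mul_omega {ε : ℝ} (hε0 : 0 ≤ ε) (hε1 : ε < 1) (hω : omega F ≠ 2) :
    omegaDiag F ε < 2 * omega F := by
  by_contra h
  exact hω (omega_eq_two_of_two_mul_omega_le_omegaDiag F hε0 hε1 (not_lt.1 h))

/-- **The thinned residual IS the summit** (`0 ≤ ε < 1`): `2ω ≤ ω_diag(ε) ⟺ ω = 2`. -/
theorem two_mul_omega_le_omegaDiag_iff {ε : ℝ} (hε0 : 0 ≤ ε) (hε1 : ε < 1) :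
    2 * omega ℂ ≤ omegaDiag ℂ ε ↔ _root_.MatrixMultiplication := by
  constructor
  · intro h
    exact _root_.MatrixMultiplication_iff.2 (omega_eq_two_of_two_mul_omega_le_omegaDiag ℂ hε0 hε1 h)
  · intro hS
    have hω : omega ℂ = 2 := _root_.MatrixMultiplication_iff.1 hS
    have h4 := four_le_omegaDiag ℂ hε1.le
    linarith

/-- **The thin-diagonal carving is exact for every `ε ∈ [0,1]`**:
`ω = 2 ⟺ [ω_diag(ε) ≤ 4] ∧ [2ω ≤ ω_diag(ε)]` (flat value `L = 4` = the cut `{0,1}|{2,3}`; at `ε = 1` this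
is the cut of record `TetraFlat ∧ TetraNoSaving`, `matrixMultiplication_iff_tetra`). -/
theorem matrixMultiplication_iff_diagFlat_and_diagNoSaving {ε : ℝ} (hε1 : ε ≤ 1) :
    _root_.MatrixMultiplication ↔ omegaDiag ℂ ε ≤ 4 ∧ 2 * omega ℂ ≤ omegaDiag ℂ ε := by
  constructor
  · intro hS
    have hω : omega ℂ = 2 := _root_.MatrixMultiplication_iff.1 hS
    have hflat : omegaDiag ℂ ε ≤ 4 :=
      omegaDiag_le_four_of_tetraFlat (omegaTetra_le_four_of_matrixMultiplication hS) hε1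
    have h4 := four_le_omegaDiag ℂ hε1
    exact ⟨hflat, by linarith⟩
  · rintro ⟨hflat, hres⟩
    have h2 := omega_two_le ℂ
    exact _root_.MatrixMultiplication_iff.2 (le_antisymm (by linarith) h2)

/-- **Degeneration of the carving off the uniform point**: for `0 ≤ ε < 1` the FLAT half is redundant —
`ω = 2 ⟺ 2ω ≤ ω_diag(ε)` — so as a decomposition node the thinned carving is the summit restated
(costume), whereas at `ε = 1` neither half is known to be redundant. -/
theorem matrixMultiplication_iff_diagNoSaving {ε : ℝ} (hε0 : 0 ≤ ε) (hε1 : ε < 1) :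
    _root_.MatrixMultiplication ↔ 2 * omega ℂ ≤ omegaDiag ℂ ε :=
  (two_mul_omega_le_omegaDiag_iff hε0 hε1).symm

/-- **Contrast: the residual of record.** For the uniform tetrahedron the summand test degenerates
(`λ = 1`, `g = 0`): `TetraNoSaving ⟺ ω(K₄) = 2ω`, consistent with every value of `ω`; with the printed
`ω(K₄) < 4.633908` it gives only `ω < 2.316954` (route header), and with `TetraFlat` exactly `ω = 2`. -/
theorem tetraNoSaving_iff_omegaTetra_eq : TetraNoSaving ↔ omegaTetra ℂ = 2 * omega ℂ :=
  two_mul_omega_le_omegaTetra_iff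

/-- **The defect form of the dichotomy** (`0 ≤ ε < 1`): either `ω = 2`, or the thinned family has a
STRICTLY SMALLER relative defect than the trivial cover predicts: `ω_diag(ε) - 4 < 2(ω - 2)`.
[cite: ChristandlVranaZuiddam2016, Prop. 1.1.16 (proof)] -/
theorem omegaDiag_defect_lt_or_summit {ε : ℝ} (hε0 : 0 ≤ ε) (hε1 : ε < 1) :
    omega F = 2 ∨ omegaDiag F ε - 4 < 2 * (omega F - 2) := by
  by_cases hω : omega F = 2
  · exact Or.inl hω
  · right
    have h := omegaDiag_lt_two_mul_omega F hε0 hε1 hω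
    linarith

end Costume

end Summit.MatrixMultiplication.MatrixMultiplication.Theorems.TetraDiagonal

end
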